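import Summits.QuantumFields.YangMills.Theorems.UnitScaleTiltProp7ConjResolventOfGreenBlockRows
import HarnessLib

/-!
# Route `UnitScaleTilt`, crux K1 «MinimiserStabilityRegPr» (stmt-QuantumFields-19200), EX rows `h137kπ` ∕ `h137kΔ` ∕ `hCk` — K-STOREY, FILE (K2b-δ₃)-S, FAMILY ∕ Idx EDITION:
# **THE `hres` FAMILY LETTER OF px10's ✓`kinvRow_family_of_coercive_of_conjResolvent` FROM AN L-ONLY `hGblk` FAMILY AT ANY SLOT FAMILY**

Cell `ym3-torus` (HUMAN RULING D-0037; rung R3 = SU(2) YM₃ on T³ — NOT d = 4, NOT infinite volume, NOT a mass gap, NOT Clay).  Width seat `ym3-torus-px12` (gen 17); sequel of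
✓`Prop7ConjResolventOfGreenBlockRows` (same seat).  THEOREMS ONLY (0 `def`, 0 `sorry`, default heartbeats); `--supports stmt-QuantumFields-19200 --as helper`; count-neutral.

WHAT IS PROVED (ns `Summit.QuantumFields.YangMills.Theorems.Prop7ConjResolventOfGreenBlockRowsFamily`).
* ★★★ `conj_resolvent_family_of_greenBlockSup` — cap `α`, L-only weights `c₀ cB`, member coupling `a L i`, slots `Δx L i`, ANY thread `Λ L i U₀` (S47: Lift); DISPLAYED FAMILY
  LETTERS under `RegPr ρ U₀ → ρ ≤ α L → Λ →`: `hpos` (the class `PosOnto`, px10's binder verbatim), `hsym` (the slot is symmetric — automatic at the two slots of record), and the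
  `hGblk` FAMILY at the slot family with L-ONLY `CG L ≥ 0` and rate `δ L` (the binder of ✓`Prop7Kernel133DoorOfKinvRow.kernel133_family_of_kinvRow_of_greenBlockSup`, at a general
  slot); an L-only slope `μ L` with `0 ≤ μ L < δ L`.  CONCLUSION: **px10's `hres` FAMILY TEXT** (✓`kinvRow_family_of_coercive_of_conjResolvent`'s binder, token for token) with the
  L-ONLY `δ₃ L := 2·((CG L·(μ L·(2∕(δ L − μ L) + 6)·e^{6μ L}))·(2(1 + 2∕(δ L − μ L)))³)` — pointwise ✓`conj_resolvent_of_greenBlockSup`.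
* ★★ `conj_resolvent_family_DeltaEtaSlot_of_greenBlockSup` — the same at the slot of record `Δx L i := DeltaEtaSlot …` (`hsym` discharged), i.e. `hres`(η)-family ⟸ px16's
  (Gb)-FAMILY `hGblk`(η) text; ★★ `conj_resolvent_family_DeltaPiSlotP_of_greenBlockSup` — the same at the Π-slot `DeltaPiSlotP … (a L i)` (`hsym` discharged).
HONEST SCOPE.  Binder plumbing over the member theorem; nothing of `hGblk`'s suppliers, `hKinv`, `h133`, `norm_G`, the EX rows, `hThm2S`, EX or the crux is proved; nothing continuum ∕
OS ∕ mass-gap ∕ Clay.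

References: T. Bałaban, CMP **99** (1985) 389–434 [Balaban1985BackgroundPropagators] (Thm 3.1 (3.46) p.398, (3.49) p.399, (3.132) p.422); CMP **96** (1984) 223–250
[Balaban1984PropagatorsII] (§2).
-/

set_option autoImplicit false

noncomputable section

open scoped BigOperators Matrix.Norms.L2Operator InnerProductSpace ComplexConjugate

namespace Summit.QuantumFields.YangMills.Theorems.Prop7ConjResolventOfGreenBlockRowsFamily

open Literature.MathematicalPhysics.QuantumFieldTheory.Balaban1983to89
open Literature.MathematicalPhysics.QuantumFieldTheory.Balaban1983to89.T3ContinuumYM3Torus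
open T3SectALandauChart (eta)
open T3PrintedRegularMinimiser (RegPr)
open B11Eq103H1Complex (BondL2K)
open B5Eq118OneStroke (iterBlockOf)
open Summit.QuantumFields.YangMills.Theorems.Prop7SectET3Transport (periodsT3)
open Summit.QuantumFields.YangMills.Theorems.Prop7SectET3HilbertLetters (W₂ toL2)
open Summit.QuantumFields.YangMills.Theorems.Prop7SectET3WilsonHessian (DeltaEtaSlot)
open Summit.QuantumFields.YangMills.Theorems.Prop7SectET3DeltaPiPInv (DeltaPiSlotP DeltaPiP_isSymmetric)
open Summit.QuantumFields.YangMills.Theorems.Prop7SectET3CurvedPropagators (GT PosOnto)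
open Summit.QuantumFields.YangMills.Theorems.Prop7CoerciveOfNormG0 (DeltaEtaSlot_isSymmetric)
open Summit.QuantumFields.YangMills.Theorems.Prop7ConjResolventOfGreenBlockRows (conj_resolvent_of_greenBlockSup)

/-- ★★★ **THE `hres` FAMILY FROM AN L-ONLY `hGblk` FAMILY, AT ANY SLOT FAMILY** (Idx edition of ✓`conj_resolvent_of_greenBlockSup`): under the thread, `PosOnto`, slot symmetry and
the `hGblk` family with L-only `CG L`, `δ L`, and a slope `0 ≤ μ L < δ L`, px10's `hres` FAMILY TEXT holds with
`δ₃ L := 2·((CG L·(μ L·(2∕(δ L − μ L) + 6)·e^{6μ L}))·(2(1 + 2∕(δ L − μ L)))³)`. [cite: Balaban1985BackgroundPropagators, Thm 3.1 (3.46) p.398, (3.49) p.399, (3.132) p.422] -/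
theorem conj_resolvent_family_of_greenBlockSup
    (α : ℕ → ℝ) (c₀ cB : ℕ → ℝ) [hc₀ : ∀ L : ℕ, Fact (0 < c₀ L)] [hcB : ∀ L : ℕ, Fact (0 < cB L)] (a : ∀ L : ℕ, T3Thm1Carrier.Idx L → ℝ)
    (Δx : ∀ (L : ℕ) (i : T3Thm1Carrier.Idx L), GaugeField (i.1.1.P i.1.2.2) 0 (Matrix.specialUnitaryGroup (Fin 2) ℂ) →
      (BondL2K ℂ 3 (periodsT3 i.1.1 i.1.2.2) (c₀ L) W₂ →ₗ[ℂ] BondL2K ℂ 3 (periodsT3 i.1.1 i.1.2.2) (c₀ L) W₂))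
    (Λ : ∀ (L : ℕ) (i : T3Thm1Carrier.Idx L), GaugeField (i.1.1.P i.1.2.2) 0 (Matrix.specialUnitaryGroup (Fin 2) ℂ) → Prop)
    (CG δ μ : ℕ → ℝ) (hCG : ∀ L, 1 < L → 0 ≤ CG L) (hμ : ∀ L, 1 < L → 0 ≤ μ L) (hμδ : ∀ L, 1 < L → μ L < δ L)
    (hpos : ∀ (L : ℕ), 1 < L → ∀ (i : T3Thm1Carrier.Idx L) (U₀ : GaugeField (i.1.1.P i.1.2.2) 0 (Matrix.specialUnitaryGroup (Fin 2) ℂ)), ∀ ρ : ℝ,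
      RegPr i.1.1 i.1.2.1 i.1.2.2 ρ U₀ → ρ ≤ α L → Λ L i U₀ → PosOnto i.1.1 i.1.2.1 i.1.2.2 i.2.2.le (c₀ L) (cB L) (a L i) (Δx L i) U₀)
    (hsym : ∀ (L : ℕ), 1 < L → ∀ (i : T3Thm1Carrier.Idx L) (U₀ : GaugeField (i.1.1.P i.1.2.2) 0 (Matrix.specialUnitaryGroup (Fin 2) ℂ)), ∀ ρ : ℝ,
      RegPr i.1.1 i.1.2.1 i.1.2.2 ρ U₀ → ρ ≤ α L → Λ L i U₀ → (Δx L i U₀).IsSymmetric)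
    (hGblk : ∀ (L : ℕ), 1 < L → ∀ (i : T3Thm1Carrier.Idx L) (U₀ : GaugeField (i.1.1.P i.1.2.2) 0 (Matrix.specialUnitaryGroup (Fin 2) ℂ)), ∀ ρ : ℝ,
      RegPr i.1.1 i.1.2.1 i.1.2.2 ρ U₀ → ρ ≤ α L → Λ L i U₀ →
      ∀ (X : PBond (i.1.1.P i.1.2.2) 0 → Matrix (Fin 2) (Fin 2) ℂ) (z : Site (i.1.1.P i.1.2.2) (i.1.2.2 - i.1.2.1)),
        (∀ b, X b ≠ 0 → iterBlockOf (i.1.2.2 - i.1.2.1) b.src = z) → ∀ s : ℝ, 0 ≤ s → (∀ b, ‖X b‖ ≤ s) →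
          ∀ bd : PBond (i.1.1.P i.1.2.2) 0,
            ‖(toL2 i.1.1 i.1.2.2 (c₀ L)).symm (GT i.1.1 i.1.2.1 i.1.2.2 i.2.2.le (c₀ L) (cB L) (a L i) (Δx L i) U₀ (toL2 i.1.1 i.1.2.2 (c₀ L) X)) bd‖
              ≤ s * CG L * Real.exp (-(δ L * (Site.tdist (P := i.1.1.P i.1.2.2) (iterBlockOf (i.1.2.2 - i.1.2.1) bd.src) z : ℝ)))) :
    ∀ (L : ℕ), 1 < L → ∀ (i : T3Thm1Carrier.Idx L) (U₀ : GaugeField (i.1.1.P i.1.2.2) 0 (Matrix.specialUnitaryGroup (Fin 2) ℂ)), ∀ ρ : ℝ,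
      RegPr i.1.1 i.1.2.1 i.1.2.2 ρ U₀ → ρ ≤ α L → Λ L i U₀ →
      ∀ φ : Site (i.1.1.P i.1.2.2) 0 → ℝ, (∀ x x' : Site (i.1.1.P i.1.2.2) 0, |φ x - φ x'| ≤ μ L * eta i.1.1 i.1.2.1 i.1.2.2 * (Site.tdist x x' : ℝ)) →
      ∀ (Mf Mfi : BondL2K ℂ 3 (periodsT3 i.1.1 i.1.2.2) (c₀ L) W₂ →ₗ[ℂ] BondL2K ℂ 3 (periodsT3 i.1.1 i.1.2.2) (c₀ L) W₂),
        (∀ X, Mf (toL2 i.1.1 i.1.2.2 (c₀ L) X) = toL2 i.1.1 i.1.2.2 (c₀ L) (fun b => Real.exp (φ b.src) • X b)) →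
        (∀ X, Mfi (toL2 i.1.1 i.1.2.2 (c₀ L) X) = toL2 i.1.1 i.1.2.2 (c₀ L) (fun b => (Real.exp (φ b.src))⁻¹ • X b)) →
        ∀ x, ‖Mf (GT i.1.1 i.1.2.1 i.1.2.2 i.2.2.le (c₀ L) (cB L) (a L i) (Δx L i) U₀ (Mfi x)) - GT i.1.1 i.1.2.1 i.1.2.2 i.2.2.le (c₀ L) (cB L) (a L i) (Δx L i) U₀ x‖
          ≤ (2 * ((CG L * (μ L * (2 / (δ L - μ L) + 6) * Real.exp (6 * μ L))) * (2 * (1 + 2 / (δ L - μ L))) ^ 3)) * ‖x‖ :=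
  fun L hL i U₀ ρ hreg hρ hl =>
    conj_resolvent_of_greenBlockSup i.1.1 i.2.2.le (c₀ L) (cB L) U₀ (a L i) (Δx L i) (hpos L hL i U₀ ρ hreg hρ hl) (hsym L hL i U₀ ρ hreg hρ hl) (hCG L hL) (hμ L hL)
      (hμδ L hL) (hGblk L hL i U₀ ρ hreg hρ hl)

/-- ★★ **THE `hres`(η) FAMILY FROM px16's (Gb)-FAMILY `hGblk`(η)** — the slot of record `Δx L i := DeltaEtaSlot`, symmetry discharged (✓`DeltaEtaSlot_isSymmetric`).
[cite: Balaban1985BackgroundPropagators, Thm 3.1 (3.46) p.398, (3.49) p.399, (3.10)–(3.12) p.392] -/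
theorem conj_resolvent_family_DeltaEtaSlot_of_greenBlockSup
    (α : ℕ → ℝ) (c₀ cB : ℕ → ℝ) [hc₀ : ∀ L : ℕ, Fact (0 < c₀ L)] [hcB : ∀ L : ℕ, Fact (0 < cB L)] (a : ∀ L : ℕ, T3Thm1Carrier.Idx L → ℝ)
    (Λ : ∀ (L : ℕ) (i : T3Thm1Carrier.Idx L), GaugeField (i.1.1.P i.1.2.2) 0 (Matrix.specialUnitaryGroup (Fin 2) ℂ) → Prop)
    (CG δ μ : ℕ → ℝ) (hCG : ∀ L, 1 < L → 0 ≤ CG L) (hμ : ∀ L, 1 < L → 0 ≤ μ L) (hμδ : ∀ L, 1 < L → μ L < δ L)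
    (hpos : ∀ (L : ℕ), 1 < L → ∀ (i : T3Thm1Carrier.Idx L) (U₀ : GaugeField (i.1.1.P i.1.2.2) 0 (Matrix.specialUnitaryGroup (Fin 2) ℂ)), ∀ ρ : ℝ,
      RegPr i.1.1 i.1.2.1 i.1.2.2 ρ U₀ → ρ ≤ α L → Λ L i U₀ → PosOnto i.1.1 i.1.2.1 i.1.2.2 i.2.2.le (c₀ L) (cB L) (a L i) (DeltaEtaSlot i.1.1 i.1.2.1 i.1.2.2 (c₀ L)) U₀)
    (hGblk : ∀ (L : ℕ), 1 < L → ∀ (i : T3Thm1Carrier.Idx L) (U₀ : GaugeField (i.1.1.P i.1.2.2) 0 (Matrix.specialUnitaryGroup (Fin 2) ℂ)), ∀ ρ : ℝ,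
      RegPr i.1.1 i.1.2.1 i.1.2.2 ρ U₀ → ρ ≤ α L → Λ L i U₀ →
      ∀ (X : PBond (i.1.1.P i.1.2.2) 0 → Matrix (Fin 2) (Fin 2) ℂ) (z : Site (i.1.1.P i.1.2.2) (i.1.2.2 - i.1.2.1)),
        (∀ b, X b ≠ 0 → iterBlockOf (i.1.2.2 - i.1.2.1) b.src = z) → ∀ s : ℝ, 0 ≤ s → (∀ b, ‖X b‖ ≤ s) →
          ∀ bd : PBond (i.1.1.P i.1.2.2) 0,
            ‖(toL2 i.1.1 i.1.2.2 (c₀ L)).symm (GT i.1.1 i.1.2.1 i.1.2.2 i.2.2.le (c₀ L) (cB L) (a L i) (DeltaEtaSlot i.1.1 i.1.2.1 i.1.2.2 (c₀ L)) U₀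
                (toL2 i.1.1 i.1.2.2 (c₀ L) X)) bd‖
              ≤ s * CG L * Real.exp (-(δ L * (Site.tdist (P := i.1.1.P i.1.2.2) (iterBlockOf (i.1.2.2 - i.1.2.1) bd.src) z : ℝ)))) :
    ∀ (L : ℕ), 1 < L → ∀ (i : T3Thm1Carrier.Idx L) (U₀ : GaugeField (i.1.1.P i.1.2.2) 0 (Matrix.specialUnitaryGroup (Fin 2) ℂ)), ∀ ρ : ℝ,
      RegPr i.1.1 i.1.2.1 i.1.2.2 ρ U₀ → ρ ≤ α L → Λ L i U₀ →
      ∀ φ : Site (i.1.1.P i.1.2.2) 0 → ℝ, (∀ x x' : Site (i.1.1.P i.1.2.2) 0, |φ x - φ x'| ≤ μ L * eta i.1.1 i.1.2.1 i.1.2.2 * (Site.tdist x x' : ℝ)) →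
      ∀ (Mf Mfi : BondL2K ℂ 3 (periodsT3 i.1.1 i.1.2.2) (c₀ L) W₂ →ₗ[ℂ] BondL2K ℂ 3 (periodsT3 i.1.1 i.1.2.2) (c₀ L) W₂),
        (∀ X, Mf (toL2 i.1.1 i.1.2.2 (c₀ L) X) = toL2 i.1.1 i.1.2.2 (c₀ L) (fun b => Real.exp (φ b.src) • X b)) →
        (∀ X, Mfi (toL2 i.1.1 i.1.2.2 (c₀ L) X) = toL2 i.1.1 i.1.2.2 (c₀ L) (fun b => (Real.exp (φ b.src))⁻¹ • X b)) →
        ∀ x, ‖Mf (GT i.1.1 i.1.2.1 i.1.2.2 i.2.2.le (c₀ L) (cB L) (a L i) (DeltaEtaSlot i.1.1 i.1.2.1 i.1.2.2 (c₀ L)) U₀ (Mfi x))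
              - GT i.1.1 i.1.2.1 i.1.2.2 i.2.2.le (c₀ L) (cB L) (a L i) (DeltaEtaSlot i.1.1 i.1.2.1 i.1.2.2 (c₀ L)) U₀ x‖
          ≤ (2 * ((CG L * (μ L * (2 / (δ L - μ L) + 6) * Real.exp (6 * μ L))) * (2 * (1 + 2 / (δ L - μ L))) ^ 3)) * ‖x‖ :=
  conj_resolvent_family_of_greenBlockSup α c₀ cB a (fun L i => DeltaEtaSlot i.1.1 i.1.2.1 i.1.2.2 (c₀ L)) Λ CG δ μ hCG hμ hμδ hpos
    (fun L _ i U₀ _ _ _ _ => DeltaEtaSlot_isSymmetric (F := i.1.1) (n := i.1.2.1) (K := i.1.2.2) (c₀ := c₀ L) U₀) hGblk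

/-- ★★ **THE `hres`(Π) FAMILY FROM N6 D3's `hGblk`(Π) FAMILY** — the Π-slot `Δx L i := DeltaPiSlotP … (a L i)`, symmetry discharged (✓`DeltaPiP_isSymmetric`).
[cite: Balaban1985BackgroundPropagators, Thm 3.12 p.423, (3.118)–(3.122) pp.419–420] -/
theorem conj_resolvent_family_DeltaPiSlotP_of_greenBlockSup
    (α : ℕ → ℝ) (c₀ cB : ℕ → ℝ) [hc₀ : ∀ L : ℕ, Fact (0 < c₀ L)] [hcB : ∀ L : ℕ, Fact (0 < cB L)] (a : ∀ L : ℕ, T3Thm1Carrier.Idx L → ℝ)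
    (Λ : ∀ (L : ℕ) (i : T3Thm1Carrier.Idx L), GaugeField (i.1.1.P i.1.2.2) 0 (Matrix.specialUnitaryGroup (Fin 2) ℂ) → Prop)
    (CG δ μ : ℕ → ℝ) (hCG : ∀ L, 1 < L → 0 ≤ CG L) (hμ : ∀ L, 1 < L → 0 ≤ μ L) (hμδ : ∀ L, 1 < L → μ L < δ L)
    (hpos : ∀ (L : ℕ), 1 < L → ∀ (i : T3Thm1Carrier.Idx L) (U₀ : GaugeField (i.1.1.P i.1.2.2) 0 (Matrix.specialUnitaryGroup (Fin 2) ℂ)), ∀ ρ : ℝ,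
      RegPr i.1.1 i.1.2.1 i.1.2.2 ρ U₀ → ρ ≤ α L → Λ L i U₀ →
        PosOnto i.1.1 i.1.2.1 i.1.2.2 i.2.2.le (c₀ L) (cB L) (a L i) (DeltaPiSlotP i.1.1 i.1.2.1 i.1.2.2 i.2.2.le (c₀ L) (cB L) (a L i)) U₀)
    (hGblk : ∀ (L : ℕ), 1 < L → ∀ (i : T3Thm1Carrier.Idx L) (U₀ : GaugeField (i.1.1.P i.1.2.2) 0 (Matrix.specialUnitaryGroup (Fin 2) ℂ)), ∀ ρ : ℝ,
      RegPr i.1.1 i.1.2.1 i.1.2.2 ρ U₀ → ρ ≤ α L → Λ L i U₀ →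
      ∀ (X : PBond (i.1.1.P i.1.2.2) 0 → Matrix (Fin 2) (Fin 2) ℂ) (z : Site (i.1.1.P i.1.2.2) (i.1.2.2 - i.1.2.1)),
        (∀ b, X b ≠ 0 → iterBlockOf (i.1.2.2 - i.1.2.1) b.src = z) → ∀ s : ℝ, 0 ≤ s → (∀ b, ‖X b‖ ≤ s) →
          ∀ bd : PBond (i.1.1.P i.1.2.2) 0,
            ‖(toL2 i.1.1 i.1.2.2 (c₀ L)).symm (GT i.1.1 i.1.2.1 i.1.2.2 i.2.2.le (c₀ L) (cB L) (a L i)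
                (DeltaPiSlotP i.1.1 i.1.2.1 i.1.2.2 i.2.2.le (c₀ L) (cB L) (a L i)) U₀ (toL2 i.1.1 i.1.2.2 (c₀ L) X)) bd‖
              ≤ s * CG L * Real.exp (-(δ L * (Site.tdist (P := i.1.1.P i.1.2.2) (iterBlockOf (i.1.2.2 - i.1.2.1) bd.src) z : ℝ)))) :
    ∀ (L : ℕ), 1 < L → ∀ (i : T3Thm1Carrier.Idx L) (U₀ : GaugeField (i.1.1.P i.1.2.2) 0 (Matrix.specialUnitaryGroup (Fin 2) ℂ)), ∀ ρ : ℝ,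
      RegPr i.1.1 i.1.2.1 i.1.2.2 ρ U₀ → ρ ≤ α L → Λ L i U₀ →
      ∀ φ : Site (i.1.1.P i.1.2.2) 0 → ℝ, (∀ x x' : Site (i.1.1.P i.1.2.2) 0, |φ x - φ x'| ≤ μ L * eta i.1.1 i.1.2.1 i.1.2.2 * (Site.tdist x x' : ℝ)) →
      ∀ (Mf Mfi : BondL2K ℂ 3 (periodsT3 i.1.1 i.1.2.2) (c₀ L) W₂ →ₗ[ℂ] BondL2K ℂ 3 (periodsT3 i.1.1 i.1.2.2) (c₀ L) W₂),
        (∀ X, Mf (toL2 i.1.1 i.1.2.2 (c₀ L) X) = toL2 i.1.1 i.1.2.2 (c₀ L) (fun b => Real.exp (φ b.src) • X b)) →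
        (∀ X, Mfi (toL2 i.1.1 i.1.2.2 (c₀ L) X) = toL2 i.1.1 i.1.2.2 (c₀ L) (fun b => (Real.exp (φ b.src))⁻¹ • X b)) →
        ∀ x, ‖Mf (GT i.1.1 i.1.2.1 i.1.2.2 i.2.2.le (c₀ L) (cB L) (a L i) (DeltaPiSlotP i.1.1 i.1.2.1 i.1.2.2 i.2.2.le (c₀ L) (cB L) (a L i)) U₀ (Mfi x))
              - GT i.1.1 i.1.2.1 i.1.2.2 i.2.2.le (c₀ L) (cB L) (a L i) (DeltaPiSlotP i.1.1 i.1.2.1 i.1.2.2 i.2.2.le (c₀ L) (cB L) (a L i)) U₀ x‖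
          ≤ (2 * ((CG L * (μ L * (2 / (δ L - μ L) + 6) * Real.exp (6 * μ L))) * (2 * (1 + 2 / (δ L - μ L))) ^ 3)) * ‖x‖ :=
  conj_resolvent_family_of_greenBlockSup α c₀ cB a (fun L i => DeltaPiSlotP i.1.1 i.1.2.1 i.1.2.2 i.2.2.le (c₀ L) (cB L) (a L i)) Λ CG δ μ hCG hμ hμδ hpos
    (fun L _ i U₀ _ _ _ _ => DeltaPiP_isSymmetric (F := i.1.1) (n := i.1.2.1) (K := i.1.2.2) (h := i.2.2.le) (c₀ := c₀ L) (cB := cB L) (a := a L i) U₀) hGblk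

end Summit.QuantumFields.YangMills.Theorems.Prop7ConjResolventOfGreenBlockRowsFamily

end
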